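import Summits.ABC.IUTFork.Cor312ThetaSideSlotTransportK
import HarnessLib

/-!
# [IUTchIII] Cor. 3.12 at the `K`-level sharp setting: the content bracket of the Θ-slot union is an INVARIANT of the Galois transport
# (both directions), so its EXACT content at every tuple of places of `K` is abc-iut-c312-3's genuine content below the tuple

PROOF-ONLY support file (D-0012; no definitions, no `Prop` facts) of the abc-iut cell (R2 S-chain team, seat abc-iut-s2-p6 gen 2, TARGET #2
`hΘ … (or =)`). TAKES NO SIDE on [IUTchIII] Cor. 3.12. Sequel to abc-iut-s2-p7's `Cor312ThetaSideSlotTransportK` (p445436), whose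
`iota_smul_normalizedPacket_subset_of_factorIso` / `…_of_section` transport the content bracket `⊆ p^m·log_p(R^×)` of the Θ-slot union ONE WAY (from the
section tuple `v̲⃗` to a tuple `e` of places of `K` above it) — enough for the UPPER bound `hΘ` (`Cor312ThetaSideClosedK`, p447368). For the remaining
half of TARGET #2 at the `K` level — NONARCHIMEDEAN EXACTNESS `−|log(Θ)|(settingPrVolSharp (pilotDataOfK D K) …) = ↑I.negLogThetaNonarch` (the
«(or =)» of the mint restricted to the finite places; for the full number it is false, abc-iut-s2-p7 `Cor312ThetaSideStrictK` p447833) — the orbit-hull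
EQUALITY `log μ̄(hull(Ind2·⋃_a ι_a(t_a)·(R_I)^∼)) = −m·log p + log μ̄(hull(log_p R_I^×))` (abc-iut-s2-p7 `packetLogμ_packetHull_orbit_slotUnion_eq`) needs the
EXACT content `m` at EVERY tuple `e`, i.e. the bracket transported BOTH ways. THIS FILE:

* §1 (`Cor312Vol`, generic over isometric `φ_a : k_a ⥲ k'_a`): `image_factorAlgEquiv_slotUnion` (`(⊗φ)(⋃_a ι_a(x_a)·(R_I)^∼) = ⋃_a ι_a(x'_a)·(R'_I)^∼`
  for `‖x'_a‖ = ‖x_a‖ ≠ 0`), **`slotUnion_subset_smul_logPacket_iff_factorIso`** (`⊆ c·log_p(R_I^×)` iff `⊆ c·log_p(R'_I^×)`),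
  `content_slotUnion_of_factorIso` (exact contents correspond);
* §2 (`Cor312Prov`, at `X := pilotDataOfK D K`, ANY realising Θ-idele `t`): **`slotUnion_subset_iff_section`** — the bracket of the `K`-level slot
  union at `e` IFF the genuine bracket of abc-iut-S2's `volumeInputOf D r` at the section tuple below `e` (isometric `K_{v̲_a} ≃ K_{e_a}`, `K/F_mod`
  Galois — [IUTchI] Rmk. 3.1.5, abc-iut-w5-d056 `exists_algEquiv_norm_eq_of_under_eq`); **`content_slotUnion_eq_contentFamily_below`** — with
  abc-iut-c312-3's exact content family `m_gen` (`exists_contentFamily`), the `K`-level slot union at every `e` over a support prime has EXACT content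
  `m_gen(p, i, v⃗(e))`: the content family read below the tuples (abc-iut-s2-p7 `Cor312ThetaSideContentBoundK`) is exact, not merely an upper bracket.

[cite: Mochizuki2012, IUTchI Rmk. 3.1.5 p. 65] [cite: Mochizuki2012, IUTchIII Prop. 3.9 (ii) p. 116] [cite: Mochizuki2012, IUTchIV Prop. 1.2 p. 10;
Thm. 1.10 Step (v) p. 27–28] [cite: DupuyHilado2025, §3.9, §4.7, §4.9, §4.12] [cite: CasselsFrohlichANT1967, Ch. VII Prop. 1.2 (ii)]
[cite: WeilBNT1967, Ch. II §2, Th. 2] [claim: Mochizuki2012, status: disputed] for every quoted construction. HONEST FRAMING: Galois / lattice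
bookkeeping about OUR typed packets and ideles; nothing here asserts or denies Cor. 3.12 for any initial Θ-data or takes a side on any author;
typed ≠ proved; instantiated ≠ endorsed.
-/

noncomputable section

open Set Function NumberField IsDedekindDomain
open scoped Pointwise

/-! ## §1. Slot unions along factorwise isometric isomorphisms: the content bracket is an INVARIANT (both directions) -/

namespace Summit.ABC.IUTFork.Cor312Vol

open Literature.IUT.LogVolume

section Generic

variable (p : ℕ) [hp : Fact p.Prime] {I : Type} [Fintype I] [DecidableEq I] [Nonempty I]
  (k : I → Type) [∀ i, NontriviallyNormedField (k i)] [∀ i, NormedAlgebra ℚ_[p] (k i)]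
  [∀ i, IsUltrametricDist (k i)] [∀ i, ProperSpace (k i)]
  (k' : I → Type) [∀ i, NontriviallyNormedField (k' i)] [∀ i, NormedAlgebra ℚ_[p] (k' i)]
  [∀ i, IsUltrametricDist (k' i)] [∀ i, ProperSpace (k' i)]
  (φ : ∀ i, k i ≃ₐ[ℚ_[p]] k' i)

/-- **The WHOLE slot union is transported**: for ISOMETRIC `φ` and slot scalars with `‖x'_a‖ = ‖x_a‖ ≠ 0`,
`(⊗φ)(⋃_a ι_a(x_a)·(R_I)^∼) = ⋃_a ι_a(x'_a)·(R'_I)^∼` (abc-iut-s2-p7 `image_factorAlgEquiv_iota_smul_normalizedPacket` slot by slot, then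
`ι_a(φ_a x_a)·(R'_I)^∼ = ι_a(x'_a)·(R'_I)^∼` by equality of absolute values, `iota_smul_normalizedPacket_eq_of_norm_eq_sameSlot`).
[cite: DupuyHilado2025, §3.9, §4.7] [cite: Mochizuki2012, IUTchIII Prop. 3.9 (ii) p. 116] -/
theorem image_factorAlgEquiv_slotUnion (hφ : ∀ i (x : k i), ‖φ i x‖ = ‖x‖) (x : ∀ a, k a) (x' : ∀ a, k' a)
    (hx : ∀ a, x a ≠ 0) (hxx' : ∀ a, ‖x' a‖ = ‖x a‖) :
    factorAlgEquiv p k k' φ '' (⋃ a, iota p k a (x a) • (normalizedPacket p k : Set (PacketAlgebra p k))) =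
      ⋃ a, iota p k' a (x' a) • (normalizedPacket p k' : Set (PacketAlgebra p k')) := by
  rw [image_iUnion]
  refine iUnion_congr fun a => ?_
  rw [image_factorAlgEquiv_iota_smul_normalizedPacket]
  exact (iota_smul_normalizedPacket_eq_of_norm_eq_sameSlot p k' a ((map_ne_zero (φ a)).mpr (hx a))
    (by rw [hxx', hφ])).symm

/-- **The content bracket of a slot union is INVARIANT along factorwise isometric isomorphisms (both directions)**: for `‖x'_a‖ = ‖x_a‖ ≠ 0`
and any scalar `c ∈ ℚ_p`, `⋃_a ι_a(x_a)·(R_I)^∼ ⊆ c·log_p(R_I^×) ⟺ ⋃_a ι_a(x'_a)·(R'_I)^∼ ⊆ c·log_p(R'_I^×)` — so the EXACT content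
(abc-iut-c312-3: the largest `m` with `⊆ p^m·log_p(R^×)`) of the two slot unions is the same (the one-directional, one-slot form is abc-iut-s2-p7's
`iota_smul_normalizedPacket_subset_of_factorIso`). [cite: DupuyHilado2025, §4.7, §4.12] [cite: Mochizuki2012, IUTchIV Prop. 1.2 p. 10] -/
theorem slotUnion_subset_smul_logPacket_iff_factorIso (hφ : ∀ i (x : k i), ‖φ i x‖ = ‖x‖) (x : ∀ a, k a)
    (x' : ∀ a, k' a) (hx : ∀ a, x a ≠ 0) (hxx' : ∀ a, ‖x' a‖ = ‖x a‖) (c : ℚ_[p]) :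
    (⋃ a, iota p k a (x a) • (normalizedPacket p k : Set (PacketAlgebra p k))) ⊆
        c • (logPacket p k : Set (PacketAlgebra p k)) ↔
      (⋃ a, iota p k' a (x' a) • (normalizedPacket p k' : Set (PacketAlgebra p k'))) ⊆
        c • (logPacket p k' : Set (PacketAlgebra p k')) := by
  rw [← image_subset_image_iff (factorAlgEquiv p k k' φ).injective,
    image_factorAlgEquiv_slotUnion p k k' φ hφ x x' hx hxx', image_const_smul_factor, image_logPacket_factor p k k' φ hφ]

/-- **Exact contents correspond**: if `m` is the exact content of `⋃_a ι_a(x_a)·(R_I)^∼` (inside `p^m·log_p(R_I^×)`, not inside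
`p^{m+1}·log_p(R_I^×)`), then `m` is the exact content of `⋃_a ι_a(x'_a)·(R'_I)^∼` for `‖x'_a‖ = ‖x_a‖` along isometric `φ`.
[cite: DupuyHilado2025, §4.12] [cite: WeilBNT1967, Ch. II §2, Th. 2] -/
theorem content_slotUnion_of_factorIso (hφ : ∀ i (x : k i), ‖φ i x‖ = ‖x‖) (x : ∀ a, k a) (x' : ∀ a, k' a)
    (hx : ∀ a, x a ≠ 0) (hxx' : ∀ a, ‖x' a‖ = ‖x a‖) {m : ℤ}
    (hm : (⋃ a, iota p k a (x a) • (normalizedPacket p k : Set (PacketAlgebra p k))) ⊆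
        ((p : ℚ_[p]) ^ m) • (logPacket p k : Set (PacketAlgebra p k)) ∧
      ¬ (⋃ a, iota p k a (x a) • (normalizedPacket p k : Set (PacketAlgebra p k))) ⊆
        ((p : ℚ_[p]) ^ (m + 1)) • (logPacket p k : Set (PacketAlgebra p k))) :
    (⋃ a, iota p k' a (x' a) • (normalizedPacket p k' : Set (PacketAlgebra p k'))) ⊆
        ((p : ℚ_[p]) ^ m) • (logPacket p k' : Set (PacketAlgebra p k')) ∧
      ¬ (⋃ a, iota p k' a (x' a) • (normalizedPacket p k' : Set (PacketAlgebra p k'))) ⊆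
        ((p : ℚ_[p]) ^ (m + 1)) • (logPacket p k' : Set (PacketAlgebra p k')) :=
  ⟨(slotUnion_subset_smul_logPacket_iff_factorIso p k k' φ hφ x x' hx hxx' _).mp hm.1,
    fun h => hm.2 ((slotUnion_subset_smul_logPacket_iff_factorIso p k k' φ hφ x x' hx hxx' _).mpr h)⟩

end Generic

end Summit.ABC.IUTFork.Cor312Vol

/-! ## §2. At the `K`-level sharp setting: the EXACT content of the Θ-slot union at EVERY tuple of places of `K` is the genuine one below it -/

namespace Summit.ABC.IUTFork.Cor312Prov

open Cor312 Cor312Vol Literature.IUT.LogThetaLattice Literature.IUT.LogVolume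
  Literature.IUT.HodgeTheaters Literature.IUT.LogVolume.ThetaData Literature.NumberTheory.NumberFields
open Thm311.Real hiding finBelow

variable {F K Fbar : Type} [Field F] [NumberField F] [Field K] [NumberField K] [Algebra F K] [Field Fbar]
  [Algebra F Fbar] [Algebra K Fbar] {E : WeierstrassCurve F} [E.IsElliptic] {l : ℕ} {Pb : BadPlacePredicates K}
  (D : InitialThetaData F K Fbar E l Pb)
  (t : ∀ (pp : Nat.Primes) (_ : Fin (pilotDataOfK D K).lstar) (x : (thetaIndex (pilotDataOfK D K)).Fibre (.inr pp)),
    haveI : Fact (pp : ℕ).Prime := ⟨pp.2⟩; kOf (pilotDataOfK D K) pp.1 x)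

/-- **The content bracket of the `K`-level Θ-slot union at a tuple `e` of places of `K` IFF the genuine one at the section tuple below `e`.**
For initial Θ-data `D` with idele data `r`, ANY realising Θ-idele `t` over `K` (v7K's `ht0`, `hT`), a tuple `e : S^±_{i+2} → 𝕍(K)_p` and `m ∈ ℤ`:
`⋃_a ι_a(t_{i,e_a})·(R_e)^∼ ⊆ p^m·log_p(R_e^×)` in abc-iut-c312-5's summand `X_e` ⟺ `⋃_b ι_b(t_{Θ,i,v_b})·(R_{v̲⃗})^∼ ⊆ p^m·log_p(R_{v̲⃗}^×)` in
abc-iut-S2's genuine packet at the section tuple `v̲⃗` below `e` — the two-directional form of abc-iut-s2-p7's slot transport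
`iota_smul_normalizedPacket_subset_of_section` (`K/F_mod` Galois, [IUTchI] Rmk. 3.1.5; isometric `K_{v̲_a} ≃ K_{e_a}`, abc-iut-w5-d056
`RescaledCompletion.exists_algEquiv_norm_eq_of_under_eq`; `‖t_{i,e_a}‖ = ‖t_{Θ,i,v_a}‖`, `norm_eq_norm_tΘ_of_realising`).
[cite: Mochizuki2012, IUTchI Rmk. 3.1.5 p. 65] [cite: CasselsFrohlichANT1967, Ch. VII Prop. 1.2 (ii)] [cite: DupuyHilado2025, §4.12] -/
theorem slotUnion_subset_iff_section {logv : PadicLogs K} (hlog : LogvAnalytic logv)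
    (r : IdeleData D) (ht0 : ∀ pp i x, t pp i x ≠ 0)
    (hT : ∀ (pp : Nat.Primes) (i : Fin (pilotDataOfK D K).lstar) (x : (thetaIndex (pilotDataOfK D K)).Fibre (.inr pp)),
      haveI : Fact (pp : ℕ).Prime := ⟨pp.2⟩
      Real.log ‖t pp i x‖ = -((pilotDataOfK D K).thetaPilot i (placeOf (pilotDataOfK D K) pp.1 x)) *
        logNorm K (placeOf (pilotDataOfK D K) pp.1 x) / localDegree K (placeOf (pilotDataOfK D K) pp.1 x))
    (pp : Nat.Primes) (i : Fin (thetaIndex (pilotDataOfK D K)).lstar)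
    (e : (thetaIndex (pilotDataOfK D K)).Caps (Setting.labelSucc i) → (thetaIndex (pilotDataOfK D K)).Fibre (.inr pp)) (m : ℤ) :
    haveI : Fact (pp : ℕ).Prime := ⟨pp.2⟩
    (⋃ a, iota pp.1 ((presAt (pilotDataOfK D K) hlog pp).kk e) a (t pp i (e a)) •
        (normalizedPacket pp.1 ((presAt (pilotDataOfK D K) hlog pp).kk e) :
          Set ((presAt (pilotDataOfK D K) hlog pp).X e))) ⊆
      (((pp : ℕ) : ℚ_[pp]) ^ m) •
        (logPacket pp.1 ((presAt (pilotDataOfK D K) hlog pp).kk e) : Set ((presAt (pilotDataOfK D K) hlog pp).X e)) ↔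
    (⋃ a : Fin ((i : ℕ) + 1 + 1),
        iota pp.1 (fun b => ((volumeInputOf D r).σ.localFieldFamily pp.1 pp.2).k
            ⟨finBelow (fieldOfModuli E) K (placeOf (pilotDataOfK D K) pp.1 (e b)),
              finBelow_mem_placesOver (fieldOfModuli E) K (placeOf_mem (pilotDataOfK D K) pp.1 (e b))⟩) a
          ((volumeInputOf D r).tΘ pp.1 pp.2 i
              ⟨finBelow (fieldOfModuli E) K (placeOf (pilotDataOfK D K) pp.1 (e a)),
                finBelow_mem_placesOver (fieldOfModuli E) K (placeOf_mem (pilotDataOfK D K) pp.1 (e a))⟩ :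
            ((volumeInputOf D r).σ.localFieldFamily pp.1 pp.2).k
              ⟨finBelow (fieldOfModuli E) K (placeOf (pilotDataOfK D K) pp.1 (e a)),
                finBelow_mem_placesOver (fieldOfModuli E) K (placeOf_mem (pilotDataOfK D K) pp.1 (e a))⟩) •
        (normalizedPacket pp.1 (fun b => ((volumeInputOf D r).σ.localFieldFamily pp.1 pp.2).k
            ⟨finBelow (fieldOfModuli E) K (placeOf (pilotDataOfK D K) pp.1 (e b)),
              finBelow_mem_placesOver (fieldOfModuli E) K (placeOf_mem (pilotDataOfK D K) pp.1 (e b))⟩) :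
          Set (PacketAlgebra pp.1 (fun b => ((volumeInputOf D r).σ.localFieldFamily pp.1 pp.2).k
            ⟨finBelow (fieldOfModuli E) K (placeOf (pilotDataOfK D K) pp.1 (e b)),
              finBelow_mem_placesOver (fieldOfModuli E) K (placeOf_mem (pilotDataOfK D K) pp.1 (e b))⟩)))) ⊆
      (((pp : ℕ) : ℚ_[pp]) ^ m) •
        (logPacket pp.1 (fun b => ((volumeInputOf D r).σ.localFieldFamily pp.1 pp.2).k
            ⟨finBelow (fieldOfModuli E) K (placeOf (pilotDataOfK D K) pp.1 (e b)),
              finBelow_mem_placesOver (fieldOfModuli E) K (placeOf_mem (pilotDataOfK D K) pp.1 (e b))⟩) :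
          Set (PacketAlgebra pp.1 (fun b => ((volumeInputOf D r).σ.localFieldFamily pp.1 pp.2).k
            ⟨finBelow (fieldOfModuli E) K (placeOf (pilotDataOfK D K) pp.1 (e b)),
              finBelow_mem_placesOver (fieldOfModuli E) K (placeOf_mem (pilotDataOfK D K) pp.1 (e b))⟩))) := by
  haveI : Fact (pp : ℕ).Prime := ⟨pp.2⟩
  haveI : IsGalois (fieldOfModuli E) K := D.isGalois_fieldOfModuli_K
  -- the section tuple below `e`
  let v : (thetaIndex (pilotDataOfK D K)).Caps (Setting.labelSucc i) → placesOver (fieldOfModuli E) pp.1 := fun b =>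
    ⟨finBelow (fieldOfModuli E) K (placeOf (pilotDataOfK D K) pp.1 (e b)),
      finBelow_mem_placesOver (fieldOfModuli E) K (placeOf_mem (pilotDataOfK D K) pp.1 (e b))⟩
  have hunder : ∀ b, ((placeSection D).lift (v b).1).under (𝓞 (fieldOfModuli E)) =
      (placeOf (pilotDataOfK D K) pp.1 (e b)).under (𝓞 (fieldOfModuli E)) := fun b => by
    rw [(placeSection D).under_lift, ← finBelow_eq_under (fieldOfModuli E) K]
  -- `K/F_mod` Galois: isometric `K_{v̲_b} ≃ₐ[ℚ_p] K_{e_b}` for every slot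
  choose φ hφ using fun b => RescaledCompletion.exists_algEquiv_norm_eq_of_under_eq (F₀ := fieldOfModuli E) (p := pp.1)
    ((placeSection D).lift (v b).1) (placeOf (pilotDataOfK D K) pp.1 (e b)) ((placeSection D).natCast_mem_lift (v b))
    (natCast_mem_placeOf (pilotDataOfK D K) pp.1 (e b)) (hunder b)
  exact (Cor312Vol.slotUnion_subset_smul_logPacket_iff_factorIso pp.1
    (fun b => ((volumeInputOf D r).σ.localFieldFamily pp.1 pp.2).k (v b)) ((presAt (pilotDataOfK D K) hlog pp).kk e)
    φ hφ (fun b => ((volumeInputOf D r).tΘ pp.1 pp.2 i (v b) : ((volumeInputOf D r).σ.localFieldFamily pp.1 pp.2).k (v b)))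
    (fun a => t pp i (e a)) (fun b => Units.ne_zero _) (fun a => norm_eq_norm_tΘ_of_realising D t r ht0 hT pp i (e a)) _).symm

/-- **The EXACT content of the `K`-level Θ-slot union at every tuple of places of `K` is abc-iut-c312-3's genuine content below it.** With
`m_gen` the exact content family of the genuine input `volumeInputOf D r` (the binder shape of `ThetaVolumeInput.exists_contentFamily`), at every
support prime `p`, label `i+1` and tuple `e : S^±_{i+2} → 𝕍(K)_p`, the slot union `⋃_a ι_a(t_{i,e_a})·(R_e)^∼` of ANY realising Θ-idele `t` over `K`
lies in `p^{m_gen(p,i,v⃗(e))}·log_p(R_e^×)` and NOT in `p^{m_gen(p,i,v⃗(e))+1}·log_p(R_e^×)`: the `K`-level content family READ BELOW the tuples is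
EXACT, not merely an upper bracket — the input of the orbit-hull EQUALITY `log μ̄(hull(Ind2·⋃)) = −m·log p + log μ̄(hull log_p R^×)`
(abc-iut-s2-p7 `packetLogμ_packetHull_orbit_slotUnion_eq`) at the `K`-level setting, i.e. of nonarchimedean EXACTNESS of `−|log(Θ)|` over `K`.
[cite: DupuyHilado2025, §4.9, §4.12] [cite: Mochizuki2012, IUTchIV Thm. 1.10 Step (v) p. 27–28] [cite: WeilBNT1967, Ch. II §2, Th. 2] -/
theorem content_slotUnion_eq_contentFamily_below {logv : PadicLogs K} (hlog : LogvAnalytic logv) (r : IdeleData D)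
    (mgen : (p : ℕ) → (i : Fin (volumeInputOf D r).lstar) → (Fin ((i : ℕ) + 1 + 1) → placesOver (fieldOfModuli E) p) → ℤ)
    (hmgen : ∀ (p : ℕ) [hp : Fact p.Prime], p ∈ (volumeInputOf D r).supportPrimes →
      ∀ (i : Fin (volumeInputOf D r).lstar) (e : Fin ((i : ℕ) + 1 + 1) → placesOver (fieldOfModuli E) p),
      (⋃ a : Fin ((i : ℕ) + 1 + 1), iota p (fun b => ((volumeInputOf D r).σ.localFieldFamily p hp.out).k (e b)) a
            ((volumeInputOf D r).tΘ p hp.out i (e a) : ((volumeInputOf D r).σ.localFieldFamily p hp.out).k (e a)) •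
          (normalizedPacket p (fun b => ((volumeInputOf D r).σ.localFieldFamily p hp.out).k (e b)) :
            Set (PacketAlgebra p (fun b => ((volumeInputOf D r).σ.localFieldFamily p hp.out).k (e b))))) ⊆
        ((p : ℚ_[p]) ^ mgen p i e) • (logPacket p (fun b => ((volumeInputOf D r).σ.localFieldFamily p hp.out).k (e b)) :
            Set (PacketAlgebra p (fun b => ((volumeInputOf D r).σ.localFieldFamily p hp.out).k (e b)))) ∧
      ¬ (⋃ a : Fin ((i : ℕ) + 1 + 1), iota p (fun b => ((volumeInputOf D r).σ.localFieldFamily p hp.out).k (e b)) a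
            ((volumeInputOf D r).tΘ p hp.out i (e a) : ((volumeInputOf D r).σ.localFieldFamily p hp.out).k (e a)) •
          (normalizedPacket p (fun b => ((volumeInputOf D r).σ.localFieldFamily p hp.out).k (e b)) :
            Set (PacketAlgebra p (fun b => ((volumeInputOf D r).σ.localFieldFamily p hp.out).k (e b))))) ⊆
        ((p : ℚ_[p]) ^ (mgen p i e + 1)) • (logPacket p (fun b => ((volumeInputOf D r).σ.localFieldFamily p hp.out).k (e b)) :
            Set (PacketAlgebra p (fun b => ((volumeInputOf D r).σ.localFieldFamily p hp.out).k (e b)))))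
    (ht0 : ∀ pp i x, t pp i x ≠ 0)
    (hT : ∀ (pp : Nat.Primes) (i : Fin (pilotDataOfK D K).lstar) (x : (thetaIndex (pilotDataOfK D K)).Fibre (.inr pp)),
      haveI : Fact (pp : ℕ).Prime := ⟨pp.2⟩
      Real.log ‖t pp i x‖ = -((pilotDataOfK D K).thetaPilot i (placeOf (pilotDataOfK D K) pp.1 x)) *
        logNorm K (placeOf (pilotDataOfK D K) pp.1 x) / localDegree K (placeOf (pilotDataOfK D K) pp.1 x))
    (pp : Nat.Primes) (hpp : (pp : ℕ) ∈ (volumeInputOf D r).supportPrimes) (i : Fin (thetaIndex (pilotDataOfK D K)).lstar)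
    (e : (thetaIndex (pilotDataOfK D K)).Caps (Setting.labelSucc i) → (thetaIndex (pilotDataOfK D K)).Fibre (.inr pp)) :
    haveI : Fact (pp : ℕ).Prime := ⟨pp.2⟩
    (⋃ a, iota pp.1 ((presAt (pilotDataOfK D K) hlog pp).kk e) a (t pp i (e a)) •
        (normalizedPacket pp.1 ((presAt (pilotDataOfK D K) hlog pp).kk e) :
          Set ((presAt (pilotDataOfK D K) hlog pp).X e))) ⊆
      (((pp : ℕ) : ℚ_[pp]) ^ mgen pp.1 i (fun b =>
          ⟨finBelow (fieldOfModuli E) K (placeOf (pilotDataOfK D K) pp.1 (e b)),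
            finBelow_mem_placesOver (fieldOfModuli E) K (placeOf_mem (pilotDataOfK D K) pp.1 (e b))⟩)) •
        (logPacket pp.1 ((presAt (pilotDataOfK D K) hlog pp).kk e) : Set ((presAt (pilotDataOfK D K) hlog pp).X e)) ∧
    ¬ (⋃ a, iota pp.1 ((presAt (pilotDataOfK D K) hlog pp).kk e) a (t pp i (e a)) •
        (normalizedPacket pp.1 ((presAt (pilotDataOfK D K) hlog pp).kk e) :
          Set ((presAt (pilotDataOfK D K) hlog pp).X e))) ⊆
      (((pp : ℕ) : ℚ_[pp]) ^ (mgen pp.1 i (fun b =>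
          ⟨finBelow (fieldOfModuli E) K (placeOf (pilotDataOfK D K) pp.1 (e b)),
            finBelow_mem_placesOver (fieldOfModuli E) K (placeOf_mem (pilotDataOfK D K) pp.1 (e b))⟩) + 1)) •
        (logPacket pp.1 ((presAt (pilotDataOfK D K) hlog pp).kk e) : Set ((presAt (pilotDataOfK D K) hlog pp).X e)) := by
  haveI : Fact (pp : ℕ).Prime := ⟨pp.2⟩
  have h := hmgen pp.1 hpp i (fun b => ⟨finBelow (fieldOfModuli E) K (placeOf (pilotDataOfK D K) pp.1 (e b)),
    finBelow_mem_placesOver (fieldOfModuli E) K (placeOf_mem (pilotDataOfK D K) pp.1 (e b))⟩)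
  exact ⟨(slotUnion_subset_iff_section D t hlog r ht0 hT pp i e _).mpr h.1,
    fun h' => h.2 ((slotUnion_subset_iff_section D t hlog r ht0 hT pp i e _).mp h')⟩

end Summit.ABC.IUTFork.Cor312Prov

end
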